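import Summits.BirchSwinnertonDyer.BirchSwinnertonDyer.Theorems.KimAtThreeD7uTamagawaSharp
import Summits.BirchSwinnertonDyer.BirchSwinnertonDyer.Theorems.KimAtThreeD7uTamagawaFreeProduct
import HarnessLib

/-!
# The TAMAGAWA-DIVISIBLE bad places, XVIII: at the FIRST LEVEL PAST THE THRESHOLD every Kolyvagin system for
# [MR04]'s `𝓕_u` on `E[3^{k+1}·3]` comes from `E[3]` — `KS(E[3^{k+1}·3], 𝓕_u) = incl_* KS(E[3], 𝓕̄_can)`
# (surjectivity half), and the push-forward `red_*` between the `𝓕_u`-modules (every `p`)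
# (cell `bsd-addord`, seat w2-tamdiv gen 6; route W2 `KimAtThreeKolyvagin`, items 19562 / 19679 / 19599 /
# 19560, «TamDiv∞» at Kolyvagin-system level)

HONEST FRAMING: TOOL theorems (no definition, no named fact, no `sorry`); closes nothing by itself;
nothing is booked; BSD is not proved by any of this.  §2 holds for every prime `p` with displayed binders
only; §3 (`p = 3`) is conditional on exactly the binders of part XV (Poitou–Tate family `inv`, `hEP`,
`T ⊇ {3} ∪ bad`, no `Γ_ℚ`-fixed points, `τ` with (H.2)-shape cokernels, canonical admissible Kolyvagin data
with ONE prime set `P` outside `T`, cyclotomic transverse conditions, ONE `η`, the level-one prime choice)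
read one level up (`τ` fixes `μ_{3^{k+2}}`, `P ⊆ 𝒫_{3^{k+2}}`) plus a datum `D₁` on `E[3]` with the same
primes (n1011-p11 GEN 6's lift data, verbatim).

## What and why

Parts XV–XVII: `KS(E[3^k·3], 𝓕_u, D k) = 0 ⟺ 3^{k+1} ∣ c_ℓ` for some `ℓ ∤ 3`; beyond the threshold
`incl_* KS(E[3^{j+1}], 𝓕_can) ↪ KS(E[3^{k+1}], 𝓕_u)`.  This file proves the converse containment at the
first level past the threshold, so that the module there is EXACTLY a copy of `KS(E[3], 𝓕̄_can)`:

* §1 `blochKatoSelmerStructure_relaxed_le_propagatedSelmerStructure` (odd `p`): `𝓕_u ≤ 𝓕_can` everywhere.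
* §2 (every `p`, `k ≤ k'`) `localMap_red_mem_blochKatoRelaxed` and
  **`isKolyvaginSystem_map_red_blochKatoRelaxed`**: for any reduction `red = p^{k'-k} : E[p^{k'}·p] → E[p^k·p]`
  the push-forward `d ↦ red_* κ_d` maps `KS(E[p^{k'}·p], 𝓕_u, D')` into `KS(E[p^k·p], 𝓕_u, D)` (part XI's
  local push-forward + n1011-p15's `isKolyvaginSystem_map` + F-B1b's transport along `red`).
* §3 (`p = 3`) **`exists_isKolyvaginSystem_map_torsionInclusion_eq`**: if `3^{k+1} ∣ c_ℓ` for ONE `ℓ ∤ 3`,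
  every Kolyvagin system `κ` of `(E[3^{k+1}·3], 𝓕_u, D (k+1))` is `incl_* λ` for a Kolyvagin system `λ` of
  `(E[3], 𝓕̄_can, D₁)`: `red_* κ ∈ KS(E[3^k·3], 𝓕_u) = 0` (part XV), so `κ = incl_* λ` by exactness of
  `0 → E[3] → E[3^{k+1}·3] → E[3^k·3] → 0` on `H¹`, and `λ` is a Kolyvagin system by n1011-p15's pull-back
  (`𝓕_u ≤ 𝓕_can` cartesian, transverse pull-back from the local shapes at Sakamoto's primes, reflection of
  the canonical comparison maps).
The sequel (part XIX, `KimAtThreeD7uTamagawaSharpLevelCard`) combines §3 with part XVII §5 into the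
identification `KS(E[3^{k+1}·3], 𝓕_u) = incl_* KS(E[3], 𝓕̄_can)` and `#KS(E[3^{k+1}·3], 𝓕_u) = #KS(E[3], 𝓕̄_can)`
when `k + 1 = max_ℓ v₃(c_ℓ)`.

References: K. Büyükboduk, JNT 129 (2009) Thm. 3.1, Cor. 3.3, §4.2; B. Mazur, K. Rubin, Mem. AMS 799 (2004)
App. A Remark A.5, Thm. 4.4.1; R. Sakamoto, JTNB 36 (2024) Def. 3.5, Def. 4.1, Thm. 4.4 (1); K. Rubin, PCMI
18 (2011) Def. 1.9.6, Prop. 1.4.13, Cor. 2.8.9.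
-/

noncomputable section

-- the cell's Theorems namespace `Summit.BirchSwinnertonDyer.BirchSwinnertonDyer.…` repeats the summit name by design (D-0017)
set_option linter.dupNamespace false

open scoped Classical NumberField ContRepresentation
open Function Field NumberField IsDedekindDomain Module
open WeierstrassCurve Literature.NumberTheory.EllipticCurves Literature.NumberTheory.GaloisRepresentations
  Literature.NumberTheory.GaloisRepresentations.DiscreteGaloisModule Literature.NumberTheory.GaloisCohomology
open Summit.BirchSwinnertonDyer.Rank1Residual Summit.BirchSwinnertonDyer.Rank1Residual.GaloisImage
open Summit.BirchSwinnertonDyer.Rank1Residual.GaloisImage.KSDevissage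
open Summit.BirchSwinnertonDyer.Rank1Residual.GaloisImage.TorsionLevel
open Summit.BirchSwinnertonDyer.BirchSwinnertonDyer.Theorems.KimAtThreeD7uBlochKatoCondition
open Summit.BirchSwinnertonDyer.BirchSwinnertonDyer.Theorems.KimAtThreeD7uKolyvaginPairBlochKato
open Summit.BirchSwinnertonDyer.BirchSwinnertonDyer.Theorems.KimAtThreeD7uTamagawaFreeStructures
open Summit.BirchSwinnertonDyer.BirchSwinnertonDyer.Theorems.KimAtThreeD7uTamagawaFreeProduct
open Summit.BirchSwinnertonDyer.BirchSwinnertonDyer.Theorems.KimAtThreeD7uTamagawaCartesian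
open Summit.BirchSwinnertonDyer.BirchSwinnertonDyer.Theorems.KimAtThreeD7uTamagawaDefectDevissage

namespace Summit.BirchSwinnertonDyer.BirchSwinnertonDyer.Theorems.KimAtThreeD7uTamagawaSharp


/-! ### §1 `𝓕_u ≤ 𝓕_can` at every place (odd `p`) -/

section Le

variable (W : WeierstrassCurve ℚ) [W.IsElliptic] (p : ℕ) [hp : Fact p.Prime] (k : ℕ)

/-- **`𝓕_u ≤ 𝓕_can` as Selmer structures on `E[p^k·p]`, `p` odd**: [MR04] Remark A.5's structure
`blochKatoSelmerStructure p (tateTorsionDatum W p k) ⊤` lies in the propagated canonical structure at every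
place — equality at `∞` (both local groups vanish, `p` odd) and above `p` (relaxed), `𝓕_u(w) ≤ 𝓕_can(w)` at
finite `w ∤ p` (part III). [cite: MazurRubin2004, App. A Remark A.5 (p. 81)] -/
theorem blochKatoSelmerStructure_relaxed_le_propagatedSelmerStructure (hp2 : p ≠ 2) :
    blochKatoSelmerStructure p (tateTorsionDatum W p k) (fun _ _ => ⊤) ≤ propagatedSelmerStructure W p k := by
  intro v
  cases v with
  | inl w => exact (blochKatoSelmerStructure_inl_eq_propagatedSelmerStructure_of_odd W p k hp2 _ w).le
  | inr w =>
    by_cases hw : ((p : ℕ) : 𝓞 ℚ) ∈ w.asIdeal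
    · exact (blochKatoSelmerStructure_relaxed_inr_eq_propagatedSelmerStructure W p k w hw).le
    · exact blochKatoSelmerStructure_inr_le_propagatedSelmerStructure W p k w _ hw

end Le

/-! ### §2 The push-forward `red_* : KS(E[p^{k'}·p], 𝓕_u, 𝒫) → KS(E[p^k·p], 𝓕_u, 𝒫)` along a reduction -/

section Red

variable (W : WeierstrassCurve ℚ) [W.IsElliptic] (p : ℕ) [hp : Fact p.Prime] {k k' : ℕ}

/-- **`red_*` maps [MR04]'s `𝓕_u` on `E[p^{k'}·p]` into `𝓕_u` on `E[p^k·p]` at EVERY place** for any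
equivariant `red` acting as `x ↦ p^{k'-k} x` (`k ≤ k'`; both structures relaxed above `p`): at finite `w ∤ p`
part XI (`localMap_red_mem_blochKatoSelmerStructure`), above `p` both are the propagated structure and
`red ∘ π_{k'+1} = π_{k+1}` (`TransportPrime.localMap_red_tateLocalMap`), nothing at `∞`.
[cite: MazurRubin2004, App. A Remark A.5 (p. 81)] [cite: Rubin2011, §3.1 (p. 29)] -/
theorem localMap_red_mem_blochKatoRelaxed (hkk : k ≤ k')
    (red : (W.torsionGaloisModule ((p : ℤ) ^ k' * (p : ℤ))).toContRepresentation →ⁱL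
      (W.torsionGaloisModule ((p : ℤ) ^ k * (p : ℤ))).toContRepresentation)
    (hred : ∀ x : geomTorsion W ((p : ℤ) ^ k' * (p : ℤ)),
      ((red x : geomTorsion W ((p : ℤ) ^ k * (p : ℤ))) : geomPoints W) =
        ((p : ℤ) ^ (k' - k)) • (x : geomPoints W))
    (v : Place ℚ) {y : galoisCohomology ((W.torsionGaloisModule ((p : ℤ) ^ k' * (p : ℤ))).toLocal v) 1}
    (hy : y ∈ blochKatoSelmerStructure p (tateTorsionDatum W p k') (fun _ _ => ⊤) v) :
    localMap red v y ∈ blochKatoSelmerStructure p (tateTorsionDatum W p k) (fun _ _ => ⊤) v := by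
  cases v with
  | inl w => exact AddSubgroup.mem_top _
  | inr w =>
    by_cases hw : ((p : ℕ) : 𝓞 ℚ) ∈ w.asIdeal
    · rw [blochKatoSelmerStructure_relaxed_inr_eq_propagatedSelmerStructure W p k' w hw] at hy
      rw [blochKatoSelmerStructure_relaxed_inr_eq_propagatedSelmerStructure W p k w hw]
      obtain ⟨z, rfl⟩ := (mem_propagatedSelmerStructure_iff W p k' _ y).mp hy
      obtain ⟨η, rfl⟩ := oneCocycleClass_surjective (tateLocalRep W p (Sum.inr w)).toTopRep z
      exact (mem_propagatedSelmerStructure_iff W p k _ _).mpr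
        ⟨_, (TransportPrime.localMap_red_tateLocalMap W p hkk red hred (Sum.inr w) η).symm⟩
    · exact localMap_red_mem_blochKatoSelmerStructure W p k w hkk red hred hw _ _ hy

/-- **THE PUSH-FORWARD `red_* : KS(E[p^{k'}·p], 𝓕_u, D') → KS(E[p^k·p], 𝓕_u, D)`** along any reduction
`red = p^{k'-k}` (every prime `p`, `k ≤ k'`): binders as in part XVII §5 (`T ⊇ {p} ∪ bad`, the same primes
outside `T`, cyclotomic transverse conditions, canonical comparison maps for ONE `η`); assembly by n1011-p15's
`KSDevissage.isKolyvaginSystem_map` with the local lemma above, functorial transverse conditions and F-B1b's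
transport of the canonical comparison maps along `red` (matched bases: part XVI `exists_bases_red_of_le`).
[cite: MazurRubin2004, App. A Remark A.5 (p. 81)] [cite: Sakamoto2024, Def. 4.1 (p. 926)] -/
theorem isKolyvaginSystem_map_red_blochKatoRelaxed (hkk : k ≤ k')
    (red : (W.torsionGaloisModule ((p : ℤ) ^ k' * (p : ℤ))).toContRepresentation →ⁱL
      (W.torsionGaloisModule ((p : ℤ) ^ k * (p : ℤ))).toContRepresentation)
    (hred : ∀ x : geomTorsion W ((p : ℤ) ^ k' * (p : ℤ)),
      ((red x : geomTorsion W ((p : ℤ) ^ k * (p : ℤ))) : geomPoints W) =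
        ((p : ℤ) ^ (k' - k)) • (x : geomPoints W))
    (T : Finset (HeightOneSpectrum (𝓞 ℚ)))
    (hpT : ∀ v : HeightOneSpectrum (𝓞 ℚ), ((p : ℕ) : 𝓞 ℚ) ∈ v.asIdeal → v ∈ T)
    (hbadT : ∀ v : HeightOneSpectrum (𝓞 ℚ), ¬ W.HasGoodReductionAt v → v ∈ T)
    {D' : KolyvaginDatum (W.torsionGaloisModule ((p : ℤ) ^ k' * (p : ℤ)))}
    {D : KolyvaginDatum (W.torsionGaloisModule ((p : ℤ) ^ k * (p : ℤ)))}
    (hP : D.primes = D'.primes) (hPT : ∀ q ∈ D'.primes, q ∉ T)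
    (hT' : D'.transverse = cyclotomicTransverse _) (hT : D.transverse = cyclotomicTransverse _)
    {η : (q : HeightOneSpectrum (𝓞 ℚ)) → (ZMod (Ideal.absNorm q.asIdeal))ˣ}
    (hD' : D'.HasCanonicalComparison (p ^ (k' + 1)) η) (hD : D.HasCanonicalComparison (p ^ (k + 1)) η)
    {κ : Finset (HeightOneSpectrum (𝓞 ℚ)) →
      galoisCohomology (W.torsionGaloisModule ((p : ℤ) ^ k' * (p : ℤ))) 1}
    (hκ : D'.IsKolyvaginSystem (blochKatoSelmerStructure p (tateTorsionDatum W p k') (fun _ _ => ⊤)) κ) :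
    D.IsKolyvaginSystem (blochKatoSelmerStructure p (tateTorsionDatum W p k) (fun _ _ => ⊤))
      (fun d => galoisCohomology.map red 1 (κ d)) := by
  classical
  haveI : NeZero (p ^ (k' + 1)) := ⟨pow_ne_zero _ hp.out.ne_zero⟩
  haveI : Fact (1 < p ^ (k + 1)) := ⟨Nat.one_lt_pow (Nat.succ_ne_zero _) hp.out.one_lt⟩
  have hgood : ∀ q ∈ D'.primes, ((p : ℕ) : 𝓞 ℚ) ∉ q.asIdeal ∧ W.HasGoodReductionAt q := fun q hq =>
    ⟨fun h => hPT q hq (hpT q h), by by_contra h; exact hPT q hq (hbadT q h)⟩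
  obtain ⟨n, b, b', hb⟩ := exists_bases_red_of_le W p hkk red hred
  refine isKolyvaginSystem_map red hP ?_ ?_ ?_ ?_ hκ
  · intro q hq
    exact (blochKatoSelmerStructure_inr_eq_unramifiedSubgroup_of_hasGoodReductionAt W p k' _
      (hgood q hq).1 (hgood q hq).2).le
  · intro v y hy
    exact localMap_red_mem_blochKatoRelaxed W p hkk red hred v hy
  · intro q hq y hy
    rw [hT'] at hy
    rw [hT]
    exact localMap_mem_cyclotomicTransverse _ q hy
  · intro q hq y hy w hw
    have hqk : q ∈ D.primes := by rw [hP]; exact hq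
    exact singularMap_localMap_eq_fs_of_hasCanonicalComparison (pow_dvd_pow p (Nat.succ_le_succ hkk))
      red b b' hb hD' hD hq hqk
      (isUnramifiedAt_torsionGaloisModule_of_hasGoodReductionAt W p k' (hgood q hq).1 (hgood q hq).2)
      (isUnramifiedAt_torsionGaloisModule_of_hasGoodReductionAt W p k (hgood q hq).1 (hgood q hq).2) hy w hw

end Red

/-! ### §3 `p = 3`: at the first level past the threshold every Kolyvagin system for `𝓕_u` comes from `E[3]` -/

section Three

variable (W : WeierstrassCurve ℚ) [W.IsElliptic]

/-- **At the first level past the threshold, `KS(E[3^{k+1}·3], 𝓕_u, D (k+1)) = incl_* KS(E[3], 𝓕̄_can, D₁)`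
(surjectivity half).**  Binders: part XV's at level `k` (so that `3^{k+1} ∣ c_ℓ` for ONE `ℓ ∤ 3` kills every
Kolyvagin system for `𝓕_u` on `E[3^k·3]`) together with n1011-p11 GEN 6's lift data one level up (`τ` fixing
`μ_{3^{k+2}}`, `P ⊆ 𝒫_{3^{k+2}}`, a datum `D₁` on `E[3]` with the same primes / cyclotomic transverse condition /
canonical comparison maps at level `3`).  CONCLUSION: every Kolyvagin system `κ` of
`(E[3^{k+1}·3], 𝓕_u = blochKatoSelmerStructure 3 (tateTorsionDatum W 3 (k+1)) ⊤, D (k+1))` is `incl_* λ` for a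
(unique) Kolyvagin system `λ` of `(E[3], 𝓕̄_can = propagatedSelmerStructureOne W 3, D₁)`: `red_* κ` is a
Kolyvagin system for `𝓕_u` on `E[3^k·3]` (§2), hence `0` (part XV), so `κ = incl_* λ` (exactness of
`0 → E[3] → E[3^{k+1}·3] → E[3^k·3] → 0` on `H¹`), and `λ` is a Kolyvagin system by n1011-p15's pull-back
(`𝓕_u ≤ 𝓕_can` CARTESIAN along `incl`, transverse pull-back from the local shapes at Sakamoto's primes,
reflection of the canonical comparison maps).  With part XVII §5 (`incl_*` maps `KS(E[3], 𝓕_can)` INTO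
`KS(E[3^{k+1}·3], 𝓕_u)` as soon as `v₃(c_w) ≤ k + 1` everywhere) this identifies `KS(E[3^{k+1}·3], 𝓕_u)` with
`KS(E[3], 𝓕̄_can)` (free of rank one over `𝔽₃`, [S24] Thm. 4.4 (1)) when `k + 1 = max_ℓ v₃(c_ℓ)`.
[cite: Buyukboduk2009TamagawaDefect, Thm. 3.1 and §4.2] [cite: MazurRubin2004, App. A Remark A.5 (p. 81)]
[cite: Sakamoto2024, Def. 3.5 (p. 923) and Thm. 4.4 (1) (p. 926)] -/
theorem exists_isKolyvaginSystem_map_torsionInclusion_eq [Finite (geomTorsion W ((3 : ℕ) : ℤ))]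
    [Finite (geomTorsion W (((3 : ℕ) : ℤ) ^ 0 * ((3 : ℕ) : ℤ)))]
    {inv : LocalInvariants ℚ 3}
    (hperf : inv.IsPerfect) (hsum : inv.SumLocalTermEqZero) (hcompl : inv.SelmerComplement)
    (hEP : ∀ v : HeightOneSpectrum (𝓞 ℚ), localEulerPoincareCharacteristic (v.adicCompletion ℚ))
    (T : Finset (HeightOneSpectrum (𝓞 ℚ)))
    (h3T : ∀ v : HeightOneSpectrum (𝓞 ℚ), ((3 : ℕ) : 𝓞 ℚ) ∈ v.asIdeal → v ∈ T)
    (hbadT : ∀ v : HeightOneSpectrum (𝓞 ℚ), ¬ W.HasGoodReductionAt v → v ∈ T) (k : ℕ)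
    {ℓ : HeightOneSpectrum (𝓞 ℚ)} (h3ℓ : ((3 : ℕ) : 𝓞 ℚ) ∉ ℓ.asIdeal)
    (hk : 3 ^ (k + 1) ∣ (W.baseChange (ℓ.adicCompletion ℚ)).localTamagawaNumber (ℓ.adicCompletionIntegers ℚ))
    (h0 : ∀ (j : ℕ) (P : geomTorsion W (((3 : ℕ) : ℤ) ^ j * ((3 : ℕ) : ℤ))),
      (∀ σ : absoluteGaloisGroup ℚ,
        W.torsionGaloisModule (((3 : ℕ) : ℤ) ^ j * ((3 : ℕ) : ℤ)) σ P = P) → P = 0)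
    {Sset : Set (HeightOneSpectrum (𝓞 ℚ))} {τ : absoluteGaloisGroup ℚ}
    (hτ : ∀ j : ℕ, Nonempty (cokerSubOne (W.torsionGaloisModule (((3 : ℕ) : ℤ) ^ j * ((3 : ℕ) : ℤ))) τ ≃+
      ZMod (3 ^ (j + 1))))
    (hτ₁ : Nonempty (cokerSubOne (W.torsionGaloisModule ((3 : ℕ) : ℤ)) τ ≃+ ZMod 3))
    (hτμ : τ ∈ rootsOfUnityFixer ℚ (3 ^ (k + 1 + 1)))
    (D : (j : ℕ) → KolyvaginDatum (W.torsionGaloisModule (((3 : ℕ) : ℤ) ^ j * ((3 : ℕ) : ℤ))))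
    (D₁ : KolyvaginDatum (W.torsionGaloisModule ((3 : ℕ) : ℤ)))
    {P : Set (HeightOneSpectrum (𝓞 ℚ))} (hP : ∀ j, (D j).primes = P) (hP₁ : D₁.primes = P)
    (hPT : ∀ q ∈ P, q ∉ T)
    (hPc : P ⊆ frobeniusClassPrimes
      (W.torsionGaloisModule (((3 : ℕ) : ℤ) ^ (k + 1) * ((3 : ℕ) : ℤ))) Sset τ (3 ^ (k + 1 + 1)))
    (hT : ∀ j, (D j).transverse = cyclotomicTransverse _) (hT₁ : D₁.transverse = cyclotomicTransverse _)
    {η : (q : HeightOneSpectrum (𝓞 ℚ)) → (ZMod (Ideal.absNorm q.asIdeal))ˣ}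
    (hD : ∀ j, (D j).HasCanonicalComparison (3 ^ (j + 1)) η) (hD₁ : D₁.HasCanonicalComparison 3 η)
    (hadm : ∀ j, (D j).IsAdmissible)
    (hprime : ∀ c : galoisCohomology (W.torsionGaloisModule (((3 : ℕ) : ℤ) ^ 0 * ((3 : ℕ) : ℤ))) 1, c ≠ 0 →
      ∀ c' : galoisCohomology (DiscreteGaloisModule.tateDual
        (W.torsionGaloisModule (((3 : ℕ) : ℤ) ^ 0 * ((3 : ℕ) : ℤ))) 3) 1, c' ≠ 0 →
      {q ∈ (D 0).primes |
        galoisCohomology.localization (W.torsionGaloisModule (((3 : ℕ) : ℤ) ^ 0 * ((3 : ℕ) : ℤ)))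
          (Sum.inr q) 1 c ≠ 0 ∧
        galoisCohomology.localization (DiscreteGaloisModule.tateDual
          (W.torsionGaloisModule (((3 : ℕ) : ℤ) ^ 0 * ((3 : ℕ) : ℤ))) 3) (Sum.inr q) 1 c' ≠ 0}.Infinite)
    {κ : Finset (HeightOneSpectrum (𝓞 ℚ)) →
      galoisCohomology (W.torsionGaloisModule (((3 : ℕ) : ℤ) ^ (k + 1) * ((3 : ℕ) : ℤ))) 1}
    (hκ : (D (k + 1)).IsKolyvaginSystem
      (blochKatoSelmerStructure 3 (tateTorsionDatum W 3 (k + 1)) (fun _ _ => ⊤)) κ) :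
    ∃ lam : Finset (HeightOneSpectrum (𝓞 ℚ)) → galoisCohomology (W.torsionGaloisModule ((3 : ℕ) : ℤ)) 1,
      D₁.IsKolyvaginSystem (propagatedSelmerStructureOne W 3) lam ∧
        ∀ d, galoisCohomology.map (W.torsionInclusion (three_dvd_pow_succ_mul k)) 1 (lam d) = κ d := by
  classical
  haveI : Fact (Nat.Prime 3) := ⟨Nat.prime_three⟩
  haveI : Fact (1 < 3) := ⟨by norm_num⟩
  haveI : Fact (1 < 3 ^ (k + 1)) := ⟨Nat.one_lt_pow (Nat.succ_ne_zero _) (by norm_num)⟩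
  haveI : NeZero (3 ^ (k + 1 + 1)) := ⟨pow_ne_zero _ (by norm_num)⟩
  haveI : NeZero (3 ^ (k + 1)) := ⟨pow_ne_zero _ (by norm_num)⟩
  haveI : Finite (geomTorsion W (((3 : ℕ) : ℤ) ^ (k + 1) * ((3 : ℕ) : ℤ))) :=
    finite_geomTorsion_pow_mul W 3 (k + 1)
  haveI : Finite (geomTorsion W (((3 : ℕ) : ℤ) ^ k * ((3 : ℕ) : ℤ))) := finite_geomTorsion_pow_mul W 3 k
  -- the reduction `red : E[3^{k+1}·3] → E[3^k·3]`, `x ↦ 3x`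
  obtain ⟨red, hred'⟩ := exists_torsionReduction_pow_mul W 3 k (k + 1)
  have hred : ∀ x : geomTorsion W (((3 : ℕ) : ℤ) ^ (k + 1) * ((3 : ℕ) : ℤ)),
      ((red x : geomTorsion W (((3 : ℕ) : ℤ) ^ k * ((3 : ℕ) : ℤ))) : geomPoints W) =
        ((3 : ℕ) : ℤ) • (x : geomPoints W) := fun x => by
    rw [hred', Nat.add_sub_cancel_left, pow_one]
  set incl := W.torsionInclusion (three_dvd_pow_succ_mul k) with hincl
  -- bookkeeping: primes, good reduction at the primes, sub-classes, roots of unity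
  have hP₂ : (D (k + 1)).primes ⊆ frobeniusClassPrimes
      (W.torsionGaloisModule (((3 : ℕ) : ℤ) ^ (k + 1) * ((3 : ℕ) : ℤ))) Sset τ (3 ^ (k + 1 + 1)) := by
    rw [hP (k + 1)]; exact hPc
  have hgood : ∀ q ∈ (D (k + 1)).primes, ((3 : ℕ) : 𝓞 ℚ) ∉ q.asIdeal ∧ W.HasGoodReductionAt q := by
    intro q hq
    rw [hP (k + 1)] at hq
    exact ⟨fun h => hPT q hq (h3T q h), by by_contra h; exact hPT q hq (hbadT q h)⟩
  have hdvd₂₃ : 3 ^ (k + 1) ∣ 3 ^ (k + 1 + 1) := pow_dvd_pow 3 (Nat.le_succ _)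
  have hdvd₂₁ : 3 ∣ 3 ^ (k + 1 + 1) := dvd_pow_self 3 (Nat.succ_ne_zero _)
  have hker₃ : ∀ u : absoluteGaloisGroup ℚ,
      (W.torsionGaloisModule (((3 : ℕ) : ℤ) ^ (k + 1) * ((3 : ℕ) : ℤ))) u = 1 →
        (W.torsionGaloisModule (((3 : ℕ) : ℤ) ^ k * ((3 : ℕ) : ℤ))) u = 1 := fun u hu =>
    torsionGaloisModule_eq_one_of_dvd W (Transport.pow_mul_dvd_pow_mul (Nat.le_succ k)) u hu
  have hker₁ : ∀ u : absoluteGaloisGroup ℚ,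
      (W.torsionGaloisModule (((3 : ℕ) : ℤ) ^ (k + 1) * ((3 : ℕ) : ℤ))) u = 1 →
        (W.torsionGaloisModule ((3 : ℕ) : ℤ)) u = 1 := fun u hu =>
    torsionGaloisModule_eq_one_of_dvd W (three_dvd_pow_succ_mul k) u hu
  have hPc₃ : P ⊆ frobeniusClassPrimes (W.torsionGaloisModule (((3 : ℕ) : ℤ) ^ k * ((3 : ℕ) : ℤ)))
      Sset τ (3 ^ (k + 1)) := fun q hq =>
    S24Deep.frobeniusClassPrimes_mono _ _ hker₃ Sset τ hdvd₂₃ (hPc hq)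
  have hmono₁ : ∀ q ∈ (D (k + 1)).primes,
      q ∈ frobeniusClassPrimes (W.torsionGaloisModule ((3 : ℕ) : ℤ)) Sset τ 3 := fun q hq =>
    S24Deep.frobeniusClassPrimes_mono _ _ hker₁ Sset τ hdvd₂₁ (hP₂ hq)
  have hτμk : τ ∈ rootsOfUnityFixer ℚ (3 ^ (k + 1)) := rootsOfUnityFixer_le_of_dvd ℚ hdvd₂₃ hτμ
  have hτμ₁ : τ ∈ rootsOfUnityFixer ℚ 3 := rootsOfUnityFixer_le_of_dvd ℚ hdvd₂₁ hτμ
  have hM₂ : ∀ m : geomTorsion W (((3 : ℕ) : ℤ) ^ (k + 1) * ((3 : ℕ) : ℤ)), 3 ^ (k + 1 + 1) • m = 0 :=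
    pow_succ_nsmul_geomTorsion_eq_zero W 3 (k + 1)
  have hM₁ : ∀ m : geomTorsion W ((3 : ℕ) : ℤ), 3 • m = 0 := three_nsmul_geomTorsion_three W
  have hprimeN : ∀ q : HeightOneSpectrum (𝓞 ℚ), Fact (Ideal.absNorm q.asIdeal).Prime :=
    fun q => ⟨FSComp.prime_absNorm_rat q⟩
  have hne : ∀ q : HeightOneSpectrum (𝓞 ℚ),
      NeZero ((Ideal.absNorm q.asIdeal : ℕ) : q.adicCompletion ℚ) := fun q => by
    haveI : CharZero (q.adicCompletion ℚ) :=
      charZero_of_injective_algebraMap (algebraMap ℚ (q.adicCompletion ℚ)).injective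
    exact ⟨Nat.cast_ne_zero.2 (FSComp.prime_absNorm_rat q).ne_zero⟩
  -- local shapes at the Kolyvagin primes (n1011-p11 GEN 6, verbatim)
  have hsup₁ : ∀ q ∈ (D (k + 1)).primes,
      unramifiedSubgroup (GaloisRep.toLocal q (W.torsionGaloisModule ((3 : ℕ) : ℤ))) 1 ⊔
        cyclotomicTransverse (W.torsionGaloisModule ((3 : ℕ) : ℤ)) (Sum.inr q) = ⊤ := fun q hq => by
    haveI := hprimeN q; haveI := hne q
    exact unramifiedSubgroup_sup_cyclotomicTransverse_eq_top_of_mem_frobeniusClassPrimes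
      (W.torsionGaloisModule ((3 : ℕ) : ℤ)) (hmono₁ q hq)
      (absNorm_sub_one_smul_eq_zero_of_mem_frobeniusClassPrimes (W.torsionGaloisModule ((3 : ℕ) : ℤ))
        (hmono₁ q hq) hτμ₁ hM₁)
      (modPCyclotomicCharacter_surjOn_absInertia_rat_holds q)
  have hM₂' : ∀ q ∈ (D (k + 1)).primes, ∀ m : geomTorsion W (((3 : ℕ) : ℤ) ^ (k + 1) * ((3 : ℕ) : ℤ)),
      (Ideal.absNorm q.asIdeal - 1) • m = 0 := fun q hq =>
    absNorm_sub_one_smul_eq_zero_of_mem_frobeniusClassPrimes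
      (W.torsionGaloisModule (((3 : ℕ) : ℤ) ^ (k + 1) * ((3 : ℕ) : ℤ))) (hP₂ hq) hτμ hM₂
  have hU₂ : ∀ q ∈ (D (k + 1)).primes, Nat.card (unramifiedSubgroup (GaloisRep.toLocal q
      (W.torsionGaloisModule (((3 : ℕ) : ℤ) ^ (k + 1) * ((3 : ℕ) : ℤ)))) 1) = 3 ^ (k + 1 + 1) := fun q hq =>
    natCard_unramifiedSubgroup_toLocal_of_mem_frobeniusClassPrimes
      (W.torsionGaloisModule (((3 : ℕ) : ℤ) ^ (k + 1) * ((3 : ℕ) : ℤ))) (hP₂ hq) (hτ (k + 1))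
  have hTc₂ : ∀ q ∈ (D (k + 1)).primes, Nat.card ((D (k + 1)).transverse (Sum.inr q)) = 3 ^ (k + 1 + 1) :=
    fun q hq => by
      haveI := hprimeN q; haveI := hne q
      rw [hT (k + 1)]
      exact natCard_cyclotomicTransverse_rat_of_mem_frobeniusClassPrimes'
        (W.torsionGaloisModule (((3 : ℕ) : ℤ) ^ (k + 1) * ((3 : ℕ) : ℤ))) (hP₂ hq) (hτ (k + 1)) (hM₂' q hq)
  have hUT₂ : ∀ q ∈ (D (k + 1)).primes, unramifiedSubgroup (GaloisRep.toLocal q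
      (W.torsionGaloisModule (((3 : ℕ) : ℤ) ^ (k + 1) * ((3 : ℕ) : ℤ)))) 1 ⊔
        (D (k + 1)).transverse (Sum.inr q) = ⊤ := fun q hq => by
    haveI := hprimeN q; haveI := hne q
    rw [hT (k + 1)]
    exact unramifiedSubgroup_sup_cyclotomicTransverse_eq_top_of_mem_frobeniusClassPrimes
      (W.torsionGaloisModule (((3 : ℕ) : ℤ) ^ (k + 1) * ((3 : ℕ) : ℤ))) (hP₂ hq) (hM₂' q hq)
      (modPCyclotomicCharacter_surjOn_absInertia_rat_holds q)
  have hinf₂ : ∀ q ∈ (D (k + 1)).primes, unramifiedSubgroup (GaloisRep.toLocal q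
      (W.torsionGaloisModule (((3 : ℕ) : ℤ) ^ (k + 1) * ((3 : ℕ) : ℤ)))) 1 ⊓
        cyclotomicTransverse (W.torsionGaloisModule (((3 : ℕ) : ℤ) ^ (k + 1) * ((3 : ℕ) : ℤ))) (Sum.inr q) = ⊥ :=
    fun q hq => by
      rw [← hT (k + 1)]
      exact CoreRankOne.unramified_inf_transverse_eq_bot (hadm (k + 1)) hU₂ hTc₂ hUT₂ hq
  have hinjloc : ∀ q ∈ (D (k + 1)).primes, Function.Injective (localMap incl (Sum.inr q)) := fun q hq =>
    localMap_torsionInclusion_injective W k red hred q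
      (natCard_invariants_toLocal_of_mem_frobeniusClassPrimes
        (W.torsionGaloisModule (((3 : ℕ) : ℤ) ^ (k + 1) * ((3 : ℕ) : ℤ))) (hP₂ hq) (hτ (k + 1)))
      (natCard_invariants_toLocal_of_mem_frobeniusClassPrimes
        (W.torsionGaloisModule (((3 : ℕ) : ℤ) ^ k * ((3 : ℕ) : ℤ))) (hPc₃ ((hP (k + 1)) ▸ hq)) (hτ k))
      (natCard_invariants_toLocal_of_mem_frobeniusClassPrimes
        (W.torsionGaloisModule ((3 : ℕ) : ℤ)) (hmono₁ q hq) hτ₁)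
  -- Step 1–2: `red_* κ` is a Kolyvagin system for `𝓕_u` on `E[3^k·3]`, hence vanishes (part XV)
  have hredκ : (D k).IsKolyvaginSystem (blochKatoSelmerStructure 3 (tateTorsionDatum W 3 k) (fun _ _ => ⊤))
      (fun d => galoisCohomology.map red 1 (κ d)) :=
    isKolyvaginSystem_map_red_blochKatoRelaxed W 3 (Nat.le_succ k) red hred' T h3T hbadT
      ((hP k).trans (hP (k + 1)).symm) (fun q hq => hPT q ((hP (k + 1)) ▸ hq)) (hT (k + 1)) (hT k)
      (hD (k + 1)) (hD k) hκ
  have hzero : ∀ d, galoisCohomology.map red 1 (κ d) = 0 := fun d =>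
    isKolyvaginSystem_blochKatoRelaxed_apply_eq_zero_of_pow_succ_dvd W hperf hsum hcompl hEP T h3T hbadT h3ℓ
      k hk h0 hτ hτ₁ hτμk D hP hPT hPc₃ hT hD hadm hprime hredκ d
  -- Step 3: lift along `incl`
  obtain ⟨lam, hlam, hlam0⟩ := exists_lift_of_forall_mem_range incl
    (map_torsionInclusion_injective W k red hred (h0 k))
    (fun d => exists_map_torsionInclusion_eq_of_map_red_eq_zero W k red hred (κ d) (hzero d))
  -- Step 4: the lift is a Kolyvagin system for `𝓕̄_can` on `E[3]`
  obtain ⟨n₁, c, c', hc⟩ := exists_bases_torsionMulBy W k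
  refine ⟨lam, isKolyvaginSystem_lift incl (hP₁.trans (hP (k + 1)).symm) ?_ ?_ ?_ ?_ hκ hlam hlam0, hlam⟩
  · -- `𝓕̄_can` unramified at the (good) primes
    intro q hq
    exact propagatedSelmerStructureOne_le_unramifiedSubgroup W (hgood q hq).1 (hgood q hq).2
  · -- `𝓕_u ≤ 𝓕_can`, and `𝓕_can` is cartesian along `incl` (n1011-p13)
    intro v x hx
    exact mem_propagatedSelmerStructureOne_of_localMap_torsionInclusion_mem W k v x
      (blochKatoSelmerStructure_relaxed_le_propagatedSelmerStructure W 3 (k + 1) (by norm_num) v hx)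
  · -- transverse pull-back from the local shapes
    intro q hq x hx
    rw [hT (k + 1)] at hx
    rw [hT₁]
    exact mem_cyclotomicTransverse_of_localMap_mem incl q (hsup₁ q hq) (hinf₂ q hq) (hinjloc q hq) hx
  · -- reflection of the canonical comparison maps along `incl` (n1011-p15 F-B1b)
    intro q hq y hy w hw
    exact singularMap_eq_fs_of_localMap_of_hasCanonicalComparison hdvd₂₁
      (W.torsionMulBy (((3 : ℕ) : ℤ) ^ (k + 1)) ((3 : ℕ) : ℤ)) c c' hc incl
      (isSES_torsionInclusion_red W k red hred).injective (hD (k + 1)) hD₁ hq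
      (by rw [hP₁, ← hP (k + 1)]; exact hq) (hP₂ hq).2.2.1 (hmono₁ q hq).2.2.1 hy w hw


end Three

end Summit.BirchSwinnertonDyer.BirchSwinnertonDyer.Theorems.KimAtThreeD7uTamagawaSharp

end
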